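import Literature.AlgebraicGeometry.HodgeTheory.AlgebraicityPropagationAlongCurves
import Literature.AlgebraicGeometry.HodgeTheory.ComplexPointsLifting
import Literature.AlgebraicGeometry.HodgeTheory.ConjugateFibres
import Literature.AlgebraicGeometry.HodgeTheory.NonGenericComplexPointsCountable
import Literature.AlgebraicGeometry.HodgeTheory.SmoothProjectiveFamilyGenericBase
import Literature.AlgebraicGeometry.Limits.CountableSubfieldFamilyDescent
import HarnessLib

/-!
# The algebraicity locus of a global class on a smooth projective family over `ℚ̄` is a countable union of
# `ℚ̄`-closed strata: the named fact `HodgeTheory.voisin2007_algebraicityLocus_iUnion_qbarClosed` HOLDS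

C. Voisin, *Hodge loci and absolute Hodge classes*, Compos. Math. 143 (2007), §0 (the starting remark of the
Introduction), and F. Charles–C. Schnell, *Notes on absolute Hodge classes* (2014), Prop. 11.3.11 with its proof and
Lemma 11.3.14: for a smooth projective family `f₀ : 𝒳₀ ⟶ S₀` over `ℚ̄` (base quasi-projective) and a global class
`A ∈ H²ᵖ(𝒳(ℂ); ℂ)` of its complexification, the set of complex points `t ∈ S(ℂ)` with `A|_{𝒳_t}` algebraic is
`⋃ⱼ Wⱼ(ℂ)` for countably many Zariski-closed `Wⱼ ⊆ S₀` — the tree's named fact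
`HodgeTheory.voisin2007_algebraicityLocus_iUnion_qbarClosed` (`HodgeTheory/AlgebraicityLocus`, consumed by
`HodgeTheory/AlgebraicityLocusProofs`, `Markman2025/*` and the Summits routes).  This file PROVES it —
**`voisin2007_algebraicityLocus_iUnion_qbarClosed_holds`** (exact name, namespace `Literature.AlgebraicGeometry.HodgeTheory`);
the printed hypothesis "`𝒳₀` quasi-projective" is not used.  The printed proof (relative Hilbert schemes of the
projective morphism `f₀`, countably many components, each defined over `ℚ̄`) is replaced by PROPAGATION ALONG THE
`ℚ̄`-STRUCTURE: take for the `Wⱼ` the closures `\overline{x}` of the (countably many) points `x ∈ S₀` under which some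
complex point has algebraic fibre class, and show that algebraicity at one complex point over `x` propagates to every
complex point over `\overline{x}` (pull the family back to the closed subscheme `V(\overline{x})`, irreducible with
generic point over `x`).

Part 1 (`mem_algebraicClasses_of_base_pt_eq_genericPoint_of_base_pt_eq_genericPoint`; `k` countable algebraically
closed, `S₀` integral locally of finite type of ANY dimension): algebraic at ONE complex point over the generic point
of `S₀` ⟹ algebraic at EVERY complex point over the generic point — spread the support of `A|_{𝒳_s}` over a smooth
affine integral `T₀` dominating `S₀` (`exists_spread_isClosed_fiberOver_generic_smooth`), death of `q^* A` off the
spread is constant above a `k`-rational open (`map_fiberι_mem_ker_restrictCompl_iff_of_baseChangeHom'`), LIFT a second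
point `v` over `η_{S₀}` to `T` (`exists_map_eq_of_base_pt_eq`, Lang II §3), CONJUGATE it to `t` under `Aut(ℂ/k)`
(`exists_conjPoint_eq_of_base_pt_eq`, Lang III §4; only the algebraic subset is conjugated, never a Betti class),
transport the codimension bound (`forall_height_add_le_conjPoint`) and conclude by
`map_fiberι_mem_algebraicClasses_of_slice`.
Part 2 (`mem_algebraicClasses_of_forall_base_pt_eq_genericPoint`; `S₀` integral, quasi-compact, locally of finite
type): algebraic over the generic point ⟹ algebraic EVERYWHERE — Mumford's curve lemma for integral varieties
(`mumford_smoothCurve_through_two_points_of_isIntegral`) gives a smooth irreducible affine curve through `u` and a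
point over the generic point; pull back, descend the pulled-back family to a countable field
(`Limits.exists_countable_subfield_descent`, EGA IV₃ 8.8.2 (ii)), count: non-Weil-generic complex points of the curve
are countable (`countable_setOf_not_weilGeneric_of_complexification`) and so are those not over `η_{S₀}`
(`countable_of_locallyOfFiniteType`, `finite_setOf_pt_mem_of_isClosed_of_ne_univ`), so some point of the curve is
both; then `AlgebraicityPropagationAlongCurves.everywherePropagation`.
Part 3 (`exists_isIntegral_isAffine_isDominant`): an irreducible `k`-scheme locally of finite type receives a
dominant morphism from an integral affine `k`-scheme of finite type hitting a given point (an affine open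
neighbourhood with its reduced structure).
Part 4: `familyPullback_baseChangeHom` (the complexified pull-back of the family along `S₁ ⟶ S₀` is again a smooth
projective family, with the same fibre classes), `mem_algebraicClasses_of_base_pt_eq_genericPoint` (Parts 1–3 over
ANY irreducible base locally of finite type), and the named fact **`voisin2007_algebraicityLocus_iUnion_qbarClosed_holds`**.

Theorems only: no definition, no named fact (net: one Literature named fact discharged under its exact name).

Provenance: Literature home (namespace `Literature.AlgebraicGeometry.HodgeTheory.AlgebraicityLocusPropagation`) of the
Summits-side `HodgeConjecture/Theorems/PadicSemiregularLiftHodgeLocusPropagationGenericPoints`,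
`…/PadicSemiregularLiftHodgeLocusPropagationCurves`, `exists_isIntegral_isAffine_isDominant` of
`…/PadicSemiregularLiftHodgeLocusPropagationProof` and `…/PadicSemiregularLiftAlgebraicityLocusQbarClosed` (imports
`Literature/`, Mathlib and the two layers now in `HodgeTheory/SmoothProjectiveFamilyGenericBase`,
`HodgeTheory/AlgebraicityPropagationAlongCurves`); the route statements (`HodgeLocusPropagation`) stay Summits-side.
Lane `lit-hodgefound`, seat p20.

## References
* [Voisin2007HodgeLoci] C. Voisin, *Hodge loci and absolute Hodge classes*, Compos. Math. 143 (2007) 945–958, §0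
  (Introduction, first paragraph), Lemma 1.4, §3.
* [CharlesSchnell2014Notes] F. Charles, C. Schnell, *Notes on absolute Hodge classes*, in *Hodge theory*, Math. Notes
  49 (2014) 469–530, Prop. 11.3.11 (proof), Lemma 11.3.14 (arXiv:1101.3647, §3.5).
* [VoisinHodgeII2003] C. Voisin, *Hodge Theory and Complex Algebraic Geometry II* (2003), §3.3.1.
* [MumfordAV1970] D. Mumford, *Abelian Varieties* (1970), §6, Lemma.
* [Lang1958IAG] S. Lang, *Introduction to Algebraic Geometry* (1958), Ch. II §3, Ch. III §4–5.
* [EGAIV3] A. Grothendieck, *ÉGA IV₃* (1966), Thm. 8.8.2 (ii).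
-/

noncomputable section

namespace Literature.AlgebraicGeometry.HodgeTheory.AlgebraicityLocusPropagation

/-! ## Part 1: Over the generic point: one algebraic fibre gives all -/

section Part1

open _root_.CategoryTheory _root_.CategoryTheory.Limits _root_.AlgebraicGeometry TopologicalSpace _root_.Order Cardinal
open Literature.AlgebraicGeometry.Motives Literature.AlgebraicGeometry.HodgeTheory

/-- **Propagation between the complex points over the generic point — any integral base, no
quasi-projectivity of the total space.** Let `k` be a countable algebraically closed field,
`σ : k →+* ℂ`, `f₀ : 𝒳₀ ⟶ S₀` over `k` with `S₀` integral and locally of finite type, whose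
complexification `f : 𝒳 ⟶ S` is a smooth projective family of relative dimension `n`,
`A ∈ H²ᵖ(𝒳(ℂ); ℂ)`, and `s ∈ S(ℂ)` a complex point over the generic point of `S₀` with `A|_{𝒳_s}`
algebraic. Then `A|_{𝒳_v}` is algebraic for EVERY complex point `v` of `S` over the generic point
of `S₀` (module docstring: spread, death constancy over a `k`-rational open, lifting of `v` to a
complex point of the parameter scheme over its generic point, conjugation of the dimension bound,
algebraicity from death and codimension on the slice). [cite: VoisinHodgeII2003, §3.3.1]
[cite: CharlesSchnell2014Notes, Prop. 11.3.11 (proof) and Lemma 11.3.14]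
[cite: Lang1958IAG, Ch. II §3 and Ch. III §4] -/
theorem mem_algebraicClasses_of_base_pt_eq_genericPoint_of_base_pt_eq_genericPoint
    (k : Type) [Field k] [Countable k] [IsAlgClosed k] (σ : k →+* ℂ) ⦃n : ℕ⦄
    ⦃𝒳₀ S₀ : SchemeOver k⦄ (f₀ : 𝒳₀ ⟶ S₀) [IsIntegral S₀.left] [LocallyOfFiniteType S₀.hom]
    (hf : IsSmoothProjectiveFamily ((baseChangeHom σ).map f₀) n)
    (p : ℕ) (A : complexBetti ((baseChangeHom σ).obj 𝒳₀) (2 * p))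
    (s : ComplexPoints ((baseChangeHom σ).obj S₀))
    (hs : (baseChangeHomFst σ S₀).base s.pt = genericPoint S₀.left)
    (hA : complexBetti.map (fiberι ((baseChangeHom σ).map f₀) s) (2 * p) A ∈
      algebraicClasses (fiberOver ((baseChangeHom σ).map f₀) s) p)
    (v : ComplexPoints ((baseChangeHom σ).obj S₀))
    (hv : (baseChangeHomFst σ S₀).base v.pt = genericPoint S₀.left) :
    complexBetti.map (fiberι ((baseChangeHom σ).map f₀) v) (2 * p) A ∈
      algebraicClasses (fiberOver ((baseChangeHom σ).map f₀) v) p := by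
  classical
  letI := σ.toAlgebra
  haveI : CharZero k := σ.charZero
  have hK : #k ≤ ℵ₀ := Cardinal.mk_le_aleph0
  -- ### notation and standing instances
  let 𝒳 : SchemeOver ℂ := (baseChangeHom σ).obj 𝒳₀
  let S : SchemeOver ℂ := (baseChangeHom σ).obj S₀
  let f : 𝒳 ⟶ S := (baseChangeHom σ).map f₀
  let prS : S.left ⟶ S₀.left := baseChangeHomFst σ S₀
  haveI : IsProper f.left := hf.isProper
  haveI : AlgebraicGeometry.Smooth f.left := hf.smooth
  haveI : IsProper f₀.left := isProper_of_baseChangeHom_map σ f₀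
  haveI : AlgebraicGeometry.Smooth f₀.left := smooth_of_baseChangeHom_map σ f₀
  -- ### step 1: the support of `A|_{𝒳_s}` and its spread
  obtain ⟨V, hVc, hVp, hV0⟩ := mem_supportedClasses_iff_exists.1 hA
  have hfs : IsSmoothProjective n (fiberOver f s) := hf.isSmoothProjective s
  haveI := IsSmoothProjective.isLocallyNoetherian_holds hfs
  haveI := IsSmoothProjective.compactSpace_holds hfs
  haveI : IsNoetherian (fiberOver f s).left := {}
  have hVcpt : IsCompact Vᶜ := NoetherianSpace.isCompact _
  obtain ⟨T₀, 𝒲₀, hT₀aff, hT₀int, hT₀sm, h₀, hlft, hdom, g₀, q₀, Z, t, e, Hsq, hZ, hts, hgen,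
    hcomp, hslice⟩ := exists_spread_isClosed_fiberOver_generic_smooth σ f₀ s hs hVc hVcpt
  haveI := hT₀aff
  haveI := hT₀int
  haveI := hlft
  haveI := hdom
  haveI : AlgebraicGeometry.Smooth T₀.hom := hT₀sm
  -- ### instances for the parameter scheme and the spread family
  let T : SchemeOver ℂ := (baseChangeHom σ).obj T₀
  let 𝒲 : SchemeOver ℂ := (baseChangeHom σ).obj 𝒲₀
  let g : 𝒲 ⟶ T := (baseChangeHom σ).map g₀
  let q : 𝒲 ⟶ 𝒳 := (baseChangeHom σ).map q₀
  let h : T ⟶ S := (baseChangeHom σ).map h₀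
  let prT : T.left ⟶ T₀.left := baseChangeHomFst σ T₀
  let prW : 𝒲.left ⟶ 𝒲₀.left := baseChangeHomFst σ 𝒲₀
  haveI : IrreducibleSpace T.left := irreducibleSpace_baseChangeHom_left σ (X := T₀)
  haveI : AlgebraicGeometry.Smooth T.hom := smooth_baseChangeHom_hom σ (X := T₀)
  obtain ⟨d, hd⟩ := exists_smoothOfRelativeDimension_of_smooth (f := T₀.hom)
  haveI := hd
  haveI : LocallyOfFiniteType T₀.hom := by rw [← Over.w h₀]; infer_instance
  haveI : IsAffineHom T₀.hom := isAffineHom_of_isAffine T₀.hom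
  haveI : IsSeparated T₀.hom := inferInstance
  haveI : CompactSpace T₀.left := QuasiCompact.compactSpace_of_compactSpace T₀.hom
  haveI : IsProper g₀.left := MorphismProperty.of_isPullback (P := @IsProper) Hsq inferInstance
  haveI : AlgebraicGeometry.Smooth g₀.left :=
    MorphismProperty.of_isPullback (P := @AlgebraicGeometry.Smooth) Hsq inferInstance
  have HsqC : IsPullback q g f h := isPullback_baseChangeHom_map_of_isPullback' σ Hsq
  -- ### step 2: death constancy over a `k`-rational open; death and codimension at `t`
  let A' : complexBetti 𝒲 (2 * p) := complexBetti.map q (2 * p) A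
  obtain ⟨O₀, hηO₀, hconst⟩ :=
    map_fiberι_mem_ker_restrictCompl_iff_of_baseChangeHom' σ g₀ (d := d) Z hZ (2 * p) A'
  let Zc : Set 𝒲.left := (prW : 𝒲.left → 𝒲₀.left) ⁻¹' Z
  have hZc : IsClosed Zc := hZ.preimage prW.continuous
  have hslice' : e.hom.left.base ⁻¹' V = (fiberι g t).left.base ⁻¹' Zc := by
    change ⇑e.hom.left ⁻¹' V = ⇑(fiberι g t).left ⁻¹' (⇑prW ⁻¹' Z)
    rw [hslice, Scheme.Hom.comp_base, TopCat.coe_comp, Set.preimage_comp]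
  have htO₀ : prT t.pt ∈ O₀ := by
    change baseChangeHomFst σ T₀ t.pt ∈ O₀
    rw [hgen]; exact hηO₀
  have hdeath_t : complexBetti.restrictCompl (fiberOver g t) ((fiberι g t).left.base ⁻¹' Zc) (2 * p)
      (complexBetti.map (fiberι g t) (2 * p) A') = 0 :=
    restrictCompl_map_fiberι_map_eq_zero_of_fiberIso f q g e hcomp hslice' A hV0
  have hdeathT : ∀ y : ComplexPoints T, prT y.pt ∈ O₀ →
      complexBetti.restrictCompl (fiberOver g y) ((fiberι g y).left.base ⁻¹' Zc) (2 * p)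
        (complexBetti.map (fiberι g y) (2 * p) (complexBetti.map q (2 * p) A)) = 0 :=
    fun y hyO => LinearMap.mem_ker.1 ((hconst t y htO₀ hyO).1 (LinearMap.mem_ker.2 hdeath_t))
  have hcodim_t : ∀ z : (fiberOver g t).left, (fiberι g t).left.base z ∈ Zc →
      height z + p ≤ (n : ℕ∞) :=
    fun z hz => forall_height_add_le_of_fiberIso f g hfs e hslice' hVp z hz
  -- ### step 3: lift `v` to a complex point `y` of `T` over the generic point of `T₀`
  have hη : h₀.left.base (genericPoint T₀.left) = prS.base v.pt := by
    have h1 : prS.base (AlgPoints.map h t).pt = h₀.left.base (prT.base t.pt) := base_pt_map h₀ t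
    rw [hts] at h1
    change h₀.left.base (genericPoint T₀.left) = baseChangeHomFst σ S₀ v.pt
    rw [hv, ← hs]
    change baseChangeHomFst σ S₀ s.pt = _ at h1
    rw [h1]
    change h₀.left.base (genericPoint T₀.left) = h₀.left.base (baseChangeHomFst σ T₀ t.pt)
    rw [hgen]
  obtain ⟨y, hyη, hyv⟩ := exists_map_eq_of_base_pt_eq (σ := σ) h₀ hK hη
  -- `y` and `t` lie over the same point of `T₀`: they are conjugate
  obtain ⟨τ, hτ⟩ := exists_conjPoint_eq_of_base_pt_eq (σ := σ) (S₀ := T₀) hK (s := t) (t := y)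
    (by rw [hgen]; exact hyη.symm)
  -- death at `y` by constancy, codimension at `y` by conjugation
  have hyO₀ : prT y.pt ∈ O₀ := by
    change baseChangeHomFst σ T₀ y.pt ∈ O₀
    rw [hyη]; exact hηO₀
  have hdeath_y := hdeathT y hyO₀
  have hcodim_y : ∀ z : (fiberOver g y).left, (fiberι g y).left.base z ∈ Zc →
      height z + p ≤ (n : ℕ∞) := by
    rw [← hτ]
    exact forall_height_add_le_conjPoint σ g₀ τ t Z p n hcodim_t
  -- ### conclusion on `𝒳_{h y} = 𝒳_v`
  have hmem := map_fiberι_mem_algebraicClasses_of_slice f h q g HsqC y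
    (hf.isSmoothProjective _) hZc A hdeath_y hcodim_y
  rw [hyv] at hmem
  exact hmem

end Part1

/-! ## Part 2: From the generic point to every point, through a Mumford curve and countable descent -/

section Part2

open _root_.CategoryTheory _root_.CategoryTheory.Limits _root_.AlgebraicGeometry TopologicalSpace _root_.Order Cardinal
open Literature.AlgebraicGeometry.Motives Literature.AlgebraicGeometry.HodgeTheory
open Literature.AlgebraicGeometry.Limits

/-- **From the complex points over the generic point to every complex point — any integral base,
no quasi-projectivity of the total space.** Let `k` be countable algebraically closed,
`σ : k →+* ℂ`, `f₀ : 𝒳₀ ⟶ S₀` over `k` with `S₀` integral, quasi-compact and locally of finite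
type, whose complexification `f : 𝒳 ⟶ S` is a smooth projective family of relative dimension `n`,
and `A ∈ H²ᵖ(𝒳(ℂ); ℂ)` algebraic on `𝒳_v` for every complex point `v` of `S` over the generic point
of `S₀`. Then `A|_{𝒳_u}` is algebraic for EVERY complex point `u` of `S` (module docstring: Mumford
curve through `u` and a point over the generic point, countable-subfield descent of the pulled-back
family, a `k₁`-generic point of the curve with image over `η_{S₀}` by counting, then
`everywherePropagation`). [cite: MumfordAV1970, §6, Lemma] [cite: VoisinHodgeII2003, §3.3.1]
[cite: CharlesSchnell2014Notes, Prop. 11.3.11 (proof) and Lemma 11.3.14] [cite: EGAIV3, Thm. 8.8.2 (ii)] -/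
theorem mem_algebraicClasses_of_forall_base_pt_eq_genericPoint
    (k : Type) [Field k] [Countable k] [IsAlgClosed k] (σ : k →+* ℂ) ⦃n : ℕ⦄
    ⦃𝒳₀ S₀ : SchemeOver k⦄ (f₀ : 𝒳₀ ⟶ S₀) [IsIntegral S₀.left] [LocallyOfFiniteType S₀.hom]
    [CompactSpace S₀.left]
    (hf : IsSmoothProjectiveFamily ((baseChangeHom σ).map f₀) n)
    (p : ℕ) (A : complexBetti ((baseChangeHom σ).obj 𝒳₀) (2 * p))
    (hgen : ∀ v : ComplexPoints ((baseChangeHom σ).obj S₀),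
      (baseChangeHomFst σ S₀).base v.pt = genericPoint S₀.left →
        complexBetti.map (fiberι ((baseChangeHom σ).map f₀) v) (2 * p) A ∈
          algebraicClasses (fiberOver ((baseChangeHom σ).map f₀) v) p)
    (u : ComplexPoints ((baseChangeHom σ).obj S₀)) :
    complexBetti.map (fiberι ((baseChangeHom σ).map f₀) u) (2 * p) A ∈
      algebraicClasses (fiberOver ((baseChangeHom σ).map f₀) u) p := by
  classical
  letI := σ.toAlgebra
  haveI : CharZero k := σ.charZero
  have hK : #k ≤ ℵ₀ := Cardinal.mk_le_aleph0
  -- ### notation and standing instances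
  let 𝒳 : SchemeOver ℂ := (baseChangeHom σ).obj 𝒳₀
  let S : SchemeOver ℂ := (baseChangeHom σ).obj S₀
  let f : 𝒳 ⟶ S := (baseChangeHom σ).map f₀
  let prS : S.left ⟶ S₀.left := baseChangeHomFst σ S₀
  haveI : IsProper f.left := hf.isProper
  have hGI : GeometricallyIntegral S₀.hom := geometricallyIntegral_of_isAlgClosed S₀.hom
  haveI : GeometricallyIntegral S.hom := by
    change GeometricallyIntegral (pullback.snd S₀.hom (Spec.map (CommRingCat.ofHom σ)))
    exact MorphismProperty.pullback_snd (P := @GeometricallyIntegral) _ _ hGI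
  haveI : IsIntegral S.left := GeometricallyIntegral.isIntegral_of_subsingleton S.hom
  haveI : LocallyOfFiniteType S.hom := by
    change LocallyOfFiniteType (pullback.snd S₀.hom (Spec.map (CommRingCat.ofHom σ)))
    infer_instance
  -- ### a complex point `s` over the generic point, and a Mumford curve through `u` and `s`
  obtain ⟨s, hs⟩ := exists_base_pt_eq σ S₀ hK (genericPoint S₀.left)
  obtain ⟨C, γ, a', b', hCaff, hCirr, hCsm, hCdim, ha', hb'⟩ :=
    mumford_smoothCurve_through_two_points_of_isIntegral (X := S) u s
  haveI := hCaff
  haveI := hCirr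
  haveI := hCsm
  haveI : IsIntegral C.left := isIntegral_of_irreducibleSpace_of_smooth C
  haveI : SmoothOfRelativeDimension 1 C.hom :=
    smoothOfRelativeDimension_one_of_topologicalKrullDim C hCdim
  haveI : IsAffineHom C.hom := isAffineHom_of_isAffine C.hom
  haveI : IsSeparated C.hom := inferInstance
  haveI : QuasiCompact C.hom := inferInstance
  haveI : LocallyOfFiniteType C.hom := inferInstance
  -- ### the family pulled back to `C`
  let 𝒲 : SchemeOver ℂ := familyPullback f γ
  let fC : 𝒲 ⟶ C := familyPullback.snd f γ
  let qC : 𝒲 ⟶ 𝒳 := familyPullback.fst f γ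
  have hfC : IsSmoothProjectiveFamily fC n := hf.familyPullback_snd γ
  haveI : IsProper fC.left := hfC.isProper
  let AC : complexBetti 𝒲 (2 * p) := complexBetti.map qC (2 * p) A
  -- algebraicity on the fibres of `fC` is algebraicity on the fibres of `f` at the image points
  have hfib : ∀ c : ComplexPoints C,
      complexBetti.map (fiberι fC c) (2 * p) AC ∈ algebraicClasses (fiberOver fC c) p ↔
        complexBetti.map (fiberι f (AlgPoints.map γ c)) (2 * p) A ∈
          algebraicClasses (fiberOver f (AlgPoints.map γ c)) p := by
    intro c
    rw [show complexBetti.map (fiberι fC c) (2 * p) AC =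
        complexBetti.map (fiberOverFamilyPullbackIso f γ c).hom (2 * p)
          (complexBetti.map (fiberι f (AlgPoints.map γ c)) (2 * p) A) from
      map_fiberι_map_eq_map_of_fiberIso f qC fC (fiberOverFamilyPullbackIso f γ c)
        (fiberOverFamilyPullbackIso_hom_fiberι f γ c) (2 * p) A]
    exact mem_algebraicClasses_map_iff_of_iso (fiberOverFamilyPullbackIso f γ c)
  -- ### descent of the pulled-back family to a countable subfield
  obtain ⟨k₁, _, _, σ₁, 𝒳₁, C₁, f₁, e𝒳, eC, hcomm⟩ := exists_countable_subfield_descent fC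
  letI := σ₁.toAlgebra
  let C' : SchemeOver ℂ := (baseChangeHom σ₁).obj C₁
  let prC : C'.left ⟶ C₁.left := baseChangeHomFst σ₁ C₁
  have hf₁ : IsSmoothProjectiveFamily ((baseChangeHom σ₁).map f₁) n :=
    IsSmoothProjectiveFamily.of_arrowIso e𝒳 eC hcomm hfC
  obtain ⟨hirr', haff', hsm', hdim'⟩ := base_hypotheses_of_iso (S' := C') eC hCdim
  haveI := hirr'
  haveI := haff'
  haveI := hsm'
  haveI : IsIntegral C'.left := isIntegral_of_irreducibleSpace_of_smooth C'
  haveI : SmoothOfRelativeDimension 1 C'.hom :=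
    smoothOfRelativeDimension_one_of_topologicalKrullDim C' hdim'
  haveI : LocallyOfFiniteType C'.hom := inferInstance
  haveI : IsNoetherian C'.left := {}
  haveI : IrreducibleSpace C₁.left := irreducibleSpace_of_baseChangeHom σ₁ C₁
  let A₁ : complexBetti ((baseChangeHom σ₁).obj 𝒳₁) (2 * p) := complexBetti.map e𝒳.hom (2 * p) AC
  -- the composite `C' ≅ C → S` and the point of `C'` mapping to `s`
  let δ : C' ⟶ S := eC.hom ≫ γ
  let c₀ : ComplexPoints C' := AlgPoints.map eC.inv b'
  have hc₀ : AlgPoints.map δ c₀ = s := by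
    change AlgPoints.map (eC.hom ≫ γ) (AlgPoints.map eC.inv b') = s
    rw [AlgPoints.map_comp_apply, AlgPoints.map_hom_map_inv_apply, hb']
  -- ### counting: the bad complex points of `C'` are countable
  -- (1) not Weil-generic over `k₁`
  have hbad₁ : {c : ComplexPoints C' | ¬ ∀ Z : Set (ComplexPoints C'),
      IsDefinedOver σ₁ C₁ σ₁.fieldRange Z → c ∈ Z → Z = Set.univ}.Countable :=
    countable_setOf_not_weilGeneric_of_complexification σ₁ C₁ hdim'.le
  -- (2) image in `S` not over the generic point of `S₀`
  haveI : Countable S₀.left := countable_of_locallyOfFiniteType S₀.hom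
  have hbad₂ : {c : ComplexPoints C' |
      prS.base (AlgPoints.map δ c).pt ≠ genericPoint S₀.left}.Countable := by
    have hsub : {c : ComplexPoints C' | prS.base (AlgPoints.map δ c).pt ≠ genericPoint S₀.left} ⊆
        ⋃ x ∈ {x : S₀.left | x ≠ genericPoint S₀.left},
          {c : ComplexPoints C' | c.pt ∈ (δ.left ≫ prS).base ⁻¹' closure {x}} := by
      intro c hc
      simp only [Set.mem_setOf_eq] at hc
      simp only [Set.mem_iUnion, Set.mem_setOf_eq, exists_prop]
      refine ⟨prS.base (AlgPoints.map δ c).pt, hc, ?_⟩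
      simp only [Set.mem_preimage, Scheme.Hom.comp_base, TopCat.coe_comp, Function.comp_apply]
      exact subset_closure (Set.mem_singleton _)
    refine Set.Countable.mono hsub (Set.Countable.biUnion (Set.to_countable _) fun x hx => ?_)
    simp only [Set.mem_setOf_eq] at hx
    refine (finite_setOf_pt_mem_of_isClosed_of_ne_univ (S := C')
      (isClosed_closure.preimage (δ.left ≫ prS).continuous) fun huniv => ?_).countable
    -- the point `c₀ ↦ s` is not over `closure {x}` since `s` is over the generic point
    have hmem : c₀.pt ∈ (δ.left ≫ prS).base ⁻¹' closure {x} := by rw [huniv]; trivial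
    simp only [Set.mem_preimage, Scheme.Hom.comp_base, TopCat.coe_comp, Function.comp_apply] at hmem
    have hpt : prS.base (AlgPoints.map δ c₀).pt = genericPoint S₀.left := by rw [hc₀]; exact hs
    rw [AlgPoints.pt_map] at hpt
    change prS.base (δ.left.base c₀.pt) = genericPoint S₀.left at hpt
    rw [hpt] at hmem
    apply hx
    -- `η ∈ closure {x}` forces `x = η`
    have hspec : x ⤳ genericPoint S₀.left := specializes_iff_mem_closure.2 hmem
    have hgen : genericPoint S₀.left ⤳ x := (genericPoint_spec S₀.left).specializes trivial
    exact (hspec.antisymm hgen).eq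
  -- ### a good point `c⋆`: Weil-generic over `k₁`, with image over the generic point of `S₀`
  obtain ⟨cs, hcs⟩ : ∃ c : ComplexPoints C', c ∉ {c : ComplexPoints C' | ¬ ∀ Z : Set (ComplexPoints C'),
      IsDefinedOver σ₁ C₁ σ₁.fieldRange Z → c ∈ Z → Z = Set.univ} ∪
        {c : ComplexPoints C' | prS.base (AlgPoints.map δ c).pt ≠ genericPoint S₀.left} := by
    by_contra hall
    refine not_countable_univ_complexPoints_of_smoothCurve (S := C') c₀ ?_
    exact (hbad₁.union hbad₂).mono fun c _ => Classical.byContradiction fun hc => hall ⟨c, hc⟩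
  simp only [Set.mem_union, Set.mem_setOf_eq, not_or, not_not] at hcs
  obtain ⟨hcs₁, hcs₂⟩ := hcs
  have hcsη : prC.base cs.pt = genericPoint C₁.left :=
    base_pt_eq_genericPoint_of_isGenericPoint σ₁ C₁ hcs₁
  have hcs_dense : closure {prC.base cs.pt} = (Set.univ : Set C₁.left) := by
    rw [hcsη]; exact genericPoint_closure _
  -- `A₁` is algebraic on the fibre over `c⋆`
  have hAcs : complexBetti.map (fiberι ((baseChangeHom σ₁).map f₁) cs) (2 * p) A₁ ∈
      algebraicClasses (fiberOver ((baseChangeHom σ₁).map f₁) cs) p := by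
    refine (map_fiberι_mem_algebraicClasses_iff_of_arrowIso e𝒳 eC hcomm AC
      (s' := cs) (s := AlgPoints.map eC.hom cs) rfl).mpr ?_
    refine (hfib (AlgPoints.map eC.hom cs)).mpr ?_
    have h := hgen (AlgPoints.map δ cs) hcs₂
    rwa [show AlgPoints.map δ cs = AlgPoints.map γ (AlgPoints.map eC.hom cs) from
      AlgPoints.map_comp_apply eC.hom γ cs] at h
  -- ### everywhere propagation over the curve, and back to `u`
  have hall := everywherePropagation k₁ σ₁ f₁ hf₁ hirr' haff' hsm' hdim' p A₁ cs hcs_dense hAcs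
    (AlgPoints.map eC.inv a')
  have ha : complexBetti.map (fiberι fC a') (2 * p) AC ∈ algebraicClasses (fiberOver fC a') p :=
    (map_fiberι_mem_algebraicClasses_iff_of_arrowIso e𝒳 eC hcomm AC
      (AlgPoints.map_hom_map_inv_apply eC a')).mp hall
  have hu := (hfib a').mp ha
  rwa [ha'] at hu

end Part2

/-! ## Part 3: An integral affine scheme of finite type dominating an irreducible scheme at a point -/

section Part3

open _root_.CategoryTheory _root_.CategoryTheory.Limits _root_.AlgebraicGeometry TopologicalSpace _root_.Order Cardinal
open Literature.AlgebraicGeometry.Motives Literature.AlgebraicGeometry.HodgeTheory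

/-- **Through any point of an irreducible `k`-scheme passes a dominant morphism, locally of finite
type, from an integral affine `k`-scheme**: an affine open `j : Spec R ↪ S₀` through `x` is
irreducible (it contains the generic point), so the nilradical `𝔑` of `R` is prime and
`Spec (R/𝔑) → Spec R → S₀` is a surjective closed immersion onto the dense open `Spec R`
(the reduced structure on an affine open; Hartshorne II Ex. 2.3, Ex. 3.11). [cite: Hartshorne1977, II Ex. 2.3 and Prop. 3.1] -/
theorem exists_isIntegral_isAffine_isDominant {k : Type} [Field k] (S₀ : SchemeOver k)
    [IrreducibleSpace S₀.left] (x : S₀.left) :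
    ∃ (S₁ : SchemeOver k) (ι : S₁ ⟶ S₀), IsIntegral S₁.left ∧ IsAffine S₁.left ∧
      LocallyOfFiniteType ι.left ∧ IsDominant ι.left ∧ x ∈ Set.range ι.left.base := by
  classical
  obtain ⟨R, j, hj, y, hy⟩ := Scheme.exists_Spec_apply_eq x
  -- the generic point of `S₀` lies in the (open, non-empty) image of `j`
  obtain ⟨y₀, hy₀⟩ : genericPoint S₀.left ∈ Set.range j.base :=
    ((genericPoint_spec S₀.left).mem_open_set_iff j.isOpenEmbedding.isOpen_range).mpr
      ⟨x, trivial, y, hy⟩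
  -- `Spec R` is irreducible: `y₀` is a generic point
  have hcl : closure ({y₀} : Set ↥(Spec R)) = Set.univ := by
    have h1 : j.base ⁻¹' closure ({genericPoint S₀.left} : Set S₀.left) =
        closure (j.base ⁻¹' {genericPoint S₀.left}) :=
      j.isOpenEmbedding.isOpenMap.preimage_closure_eq_closure_preimage j.base.hom.continuous _
    have h2 : j.base ⁻¹' ({genericPoint S₀.left} : Set S₀.left) = {y₀} := by
      ext z
      simp only [Set.mem_preimage, Set.mem_singleton_iff]
      exact ⟨fun hz => j.isOpenEmbedding.injective (hz.trans hy₀.symm), fun hz => hz ▸ hy₀⟩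
    rw [← h2, ← h1, genericPoint_closure, Set.preimage_univ]
  haveI : IrreducibleSpace ↥(Spec R) :=
    (irreducibleSpace_def _).2 (IsGenericPoint.isIrreducible (S := Set.univ) hcl)
  -- hence the nilradical of `R` is prime
  haveI hN : (nilradical R).IsPrime := by
    have huniv : IsIrreducible (Set.univ : Set (PrimeSpectrum R)) :=
      IrreducibleSpace.isIrreducible_univ ↥(Spec R)
    have h := PrimeSpectrum.isIrreducible_iff_vanishingIdeal_isPrime.mp huniv
    rwa [PrimeSpectrum.vanishingIdeal_univ] at h
  haveI : IsDomain (R ⧸ nilradical R) := Ideal.Quotient.isDomain (nilradical (R : Type))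
  -- the reduction `Spec (R/𝔑) → Spec R`: a surjective closed immersion
  let π : (R : Type) →+* R ⧸ nilradical R := Ideal.Quotient.mk (nilradical (R : Type))
  let ι₁ : Spec (CommRingCat.of (R ⧸ nilradical R)) ⟶ Spec R := Spec.map (CommRingCat.ofHom π)
  haveI : IsClosedImmersion ι₁ :=
    IsClosedImmersion.spec_of_surjective _ Ideal.Quotient.mk_surjective
  have hsurj : Function.Surjective ι₁.base := fun z =>
    (PrimeSpectrum.comap_quotientMk_bijective_of_le_nilradical
      (I := nilradical (R : Type)) le_rfl).2 z
  let S₁ : SchemeOver k := Over.mk ((ι₁ ≫ j) ≫ S₀.hom)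
  let ι : S₁ ⟶ S₀ := Over.homMk (ι₁ ≫ j) rfl
  refine ⟨S₁, ι, ?_, ?_, ?_, ?_, ?_⟩
  · change IsIntegral (Spec (CommRingCat.of (R ⧸ nilradical R)))
    infer_instance
  · change IsAffine (Spec (CommRingCat.of (R ⧸ nilradical R)))
    infer_instance
  · change LocallyOfFiniteType (ι₁ ≫ j)
    infer_instance
  · change IsDominant (ι₁ ≫ j)
    obtain ⟨w₀, hw₀⟩ := hsurj y₀
    have hmem : genericPoint S₀.left ∈ Set.range (ι₁ ≫ j).base :=
      ⟨w₀, by simp only [Scheme.Hom.comp_base, TopCat.coe_comp, Function.comp_apply, hw₀, hy₀]⟩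
    exact ⟨(dense_iff_closure_eq.2 (genericPoint_closure _)).mono (Set.singleton_subset_iff.2 hmem)⟩
  · obtain ⟨w, hw⟩ := hsurj y
    refine ⟨w, ?_⟩
    change (ι₁ ≫ j).base w = x
    simp only [Scheme.Hom.comp_base, TopCat.coe_comp, Function.comp_apply, hw, hy]

end Part3

/-! ## Part 4: The named fact on algebraicity loci -/

section Part4

open _root_.CategoryTheory _root_.CategoryTheory.Limits _root_.AlgebraicGeometry TopologicalSpace _root_.Order Cardinal
open Literature.AlgebraicGeometry.Motives Literature.AlgebraicGeometry.HodgeTheory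

/-! ### Pulling the family back along a morphism of bases -/

section Pullback

variable {k : Type} [Field k] (σ : k →+* ℂ) {𝒳₀ S₀ S₁ : SchemeOver k} (f₀ : 𝒳₀ ⟶ S₀)
  (ι : S₁ ⟶ S₀)

/-- **The complexified pull-back of the family along `ι : S₁ ⟶ S₀`** is a smooth projective family
of the same relative dimension, and `q^* A` is algebraic on its fibre over a complex point `w` iff
`A` is algebraic on the fibre of the original family over `ι(w)` (both fibres are
`𝒳₀ ×_{S₀} Spec ℂ`; base change preserves cartesian squares, `isPullback_baseChangeHom_map_of_isPullback`;
`Nᵖ` is invariant under isomorphisms). [cite: GortzWedhorn2020, Prop. 4.16 and §(4.7)] -/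
theorem familyPullback_baseChangeHom {n : ℕ}
    (hf : IsSmoothProjectiveFamily ((baseChangeHom σ).map f₀) n) (p : ℕ)
    (A : complexBetti ((baseChangeHom σ).obj 𝒳₀) (2 * p)) :
    IsSmoothProjectiveFamily ((baseChangeHom σ).map (familyPullback.snd f₀ ι)) n ∧
      ∀ w : ComplexPoints ((baseChangeHom σ).obj S₁),
        complexBetti.map (fiberι ((baseChangeHom σ).map (familyPullback.snd f₀ ι)) w) (2 * p)
            (complexBetti.map ((baseChangeHom σ).map (familyPullback.fst f₀ ι)) (2 * p) A) ∈
          algebraicClasses (fiberOver ((baseChangeHom σ).map (familyPullback.snd f₀ ι)) w) p ↔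
        complexBetti.map (fiberι ((baseChangeHom σ).map f₀)
            (AlgPoints.map ((baseChangeHom σ).map ι) w)) (2 * p) A ∈
          algebraicClasses (fiberOver ((baseChangeHom σ).map f₀)
            (AlgPoints.map ((baseChangeHom σ).map ι) w)) p := by
  let f : (baseChangeHom σ).obj 𝒳₀ ⟶ (baseChangeHom σ).obj S₀ := (baseChangeHom σ).map f₀
  let f' : (baseChangeHom σ).obj (familyPullback f₀ ι) ⟶ (baseChangeHom σ).obj S₁ :=
    (baseChangeHom σ).map (familyPullback.snd f₀ ι)
  let q' : (baseChangeHom σ).obj (familyPullback f₀ ι) ⟶ (baseChangeHom σ).obj 𝒳₀ :=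
    (baseChangeHom σ).map (familyPullback.fst f₀ ι)
  let h' : (baseChangeHom σ).obj S₁ ⟶ (baseChangeHom σ).obj S₀ := (baseChangeHom σ).map ι
  have Hsq : IsPullback (familyPullback.fst f₀ ι).left (familyPullback.snd f₀ ι).left f₀.left ι.left :=
    IsPullback.of_hasPullback f₀.left ι.left
  have HsqC : IsPullback q' f' f h' := isPullback_baseChangeHom_map_of_isPullback' σ Hsq
  have Hl : IsPullback q'.left f'.left f.left h'.left := isPullback_baseChangeHom_map_of_isPullback σ Hsq
  refine ⟨⟨?_, ?_, fun w => ?_⟩, fun w => ?_⟩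
  · haveI := smoothOfRelativeDimension_isStableUnderBaseChange (n := n)
    exact MorphismProperty.of_isPullback (P := @SmoothOfRelativeDimension n) Hl
      hf.smoothOfRelativeDimension
  · exact MorphismProperty.of_isPullback (P := @IsProper) Hl hf.isProper
  · obtain ⟨φ, -⟩ := exists_fiberOver_iso_of_isPullback HsqC w
    exact (hf.isSmoothProjective _).of_iso φ.symm
  · obtain ⟨φ, hφ⟩ := exists_fiberOver_iso_of_isPullback HsqC w
    change complexBetti.map (fiberι f' w) (2 * p) (complexBetti.map q' (2 * p) A) ∈
        algebraicClasses (fiberOver f' w) p ↔ _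
    rw [map_fiberι_map_eq_map_of_fiberIso f q' f' φ hφ (2 * p) A]
    exact mem_algebraicClasses_map_iff_of_iso φ

end Pullback

/-! ### Propagation over any irreducible base locally of finite type -/

/-- **Propagation of algebraicity from a complex point over the generic point to every complex
point, over ANY irreducible base locally of finite type** (`k` countable algebraically closed; no
quasi-projectivity of base or total space; the base may be singular and non-reduced). Proof:
pull back to an integral affine `S₁ → S₀` through the point under `t`
(`exists_isIntegral_isAffine_isDominant`), lift `s` to a complex point over the generic point of
`S₁` and `t` to some complex point (`exists_map_eq_of_base_pt_eq`), then
`mem_algebraicClasses_of_base_pt_eq_genericPoint_of_base_pt_eq_genericPoint` and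
`mem_algebraicClasses_of_forall_base_pt_eq_genericPoint`. [cite: VoisinHodgeII2003, §3.3.1]
[cite: CharlesSchnell2014Notes, Prop. 11.3.11 (proof) and Lemma 11.3.14] -/
theorem mem_algebraicClasses_of_base_pt_eq_genericPoint (k : Type) [Field k] [Countable k]
    [IsAlgClosed k] (σ : k →+* ℂ) ⦃n : ℕ⦄ ⦃𝒳₀ S₀ : SchemeOver k⦄ (f₀ : 𝒳₀ ⟶ S₀)
    [IrreducibleSpace S₀.left] [LocallyOfFiniteType S₀.hom]
    (hf : IsSmoothProjectiveFamily ((baseChangeHom σ).map f₀) n)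
    (p : ℕ) (A : complexBetti ((baseChangeHom σ).obj 𝒳₀) (2 * p))
    (s : ComplexPoints ((baseChangeHom σ).obj S₀))
    (hs : (baseChangeHomFst σ S₀).base s.pt = genericPoint S₀.left)
    (hA : complexBetti.map (fiberι ((baseChangeHom σ).map f₀) s) (2 * p) A ∈
      algebraicClasses (fiberOver ((baseChangeHom σ).map f₀) s) p)
    (t : ComplexPoints ((baseChangeHom σ).obj S₀)) :
    complexBetti.map (fiberι ((baseChangeHom σ).map f₀) t) (2 * p) A ∈
      algebraicClasses (fiberOver ((baseChangeHom σ).map f₀) t) p := by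
  classical
  letI := σ.toAlgebra
  have hK : #k ≤ ℵ₀ := Cardinal.mk_le_aleph0
  let prS : ((baseChangeHom σ).obj S₀).left ⟶ S₀.left := baseChangeHomFst σ S₀
  -- an integral affine `S₁ → S₀`, dominant, through the point under `t`
  obtain ⟨S₁, ι, hS₁int, hS₁aff, hιlft, hιdom, y, hy⟩ :=
    exists_isIntegral_isAffine_isDominant S₀ (prS.base t.pt)
  haveI := hS₁int
  haveI := hS₁aff
  haveI := hιlft
  haveI := hιdom
  haveI : LocallyOfFiniteType S₁.hom := by rw [← Over.w ι]; infer_instance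
  haveI : IsAffineHom S₁.hom := isAffineHom_of_isAffine S₁.hom
  haveI : CompactSpace S₁.left := QuasiCompact.compactSpace_of_compactSpace S₁.hom
  obtain ⟨hf', hfib⟩ := familyPullback_baseChangeHom σ f₀ ι hf p A
  -- lift `s` over the generic point of `S₁`, and `t`
  have hη : ι.left.base (genericPoint S₁.left) = prS.base s.pt := by
    rw [hs]; exact genericPoint_eq_of_isDominant' ι.left
  obtain ⟨s', hs'η, hs's⟩ := exists_map_eq_of_base_pt_eq (σ := σ) ι hK hη
  obtain ⟨t', -, ht't⟩ := exists_map_eq_of_base_pt_eq (σ := σ) ι hK (y := y) (t := t) hy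
  have hA' := (hfib s').mpr (by rw [hs's]; exact hA)
  have hgen := fun v hv =>
    mem_algebraicClasses_of_base_pt_eq_genericPoint_of_base_pt_eq_genericPoint k σ
      (familyPullback.snd f₀ ι) hf' p _ s' hs'η hA' v hv
  have ht' := mem_algebraicClasses_of_forall_base_pt_eq_genericPoint k σ (familyPullback.snd f₀ ι)
    hf' p _ hgen t'
  have ht := (hfib t').mp ht'
  rwa [ht't] at ht

/-! ### The vendored structure fact on algebraicity loci -/

/-- **`voisin2007_algebraicityLocus_iUnion_qbarClosed` is a theorem**: for `σ : ℚ̄ →+* ℂ`, a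
family `f₀ : 𝒳₀ ⟶ S₀` over `ℚ̄` with `S₀` quasi-projective whose complexification is a smooth
projective family, and a global class `A`, the complex points `t` with `A|_{𝒳_t}` algebraic are
exactly those over countably many closed `W_j ⊆ S₀` — namely the closures of the points of `S₀`
under which some complex point has algebraic fibre class (propagation along each such closed
irreducible stratum, `mem_algebraicClasses_of_base_pt_eq_genericPoint` on the closed subscheme
`V(\overline{x})`). The printed hypothesis "`𝒳₀` quasi-projective" is not used.
[cite: Voisin2007HodgeLoci, §0 (Introduction), first paragraph] [cite: CharlesSchnell2014Notes, Prop. 11.3.11 (proof)]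
[cite: VoisinHodgeII2003, §3.3.1] -/
theorem _root_.Literature.AlgebraicGeometry.HodgeTheory.voisin2007_algebraicityLocus_iUnion_qbarClosed_holds :
    voisin2007_algebraicityLocus_iUnion_qbarClosed := by
  intro σ 𝒳₀ S₀ f₀ n p _h𝒳₀ hS₀ hf A
  classical
  letI := σ.toAlgebra
  haveI : Countable (AlgebraicClosure ℚ) :=
    Cardinal.mk_le_aleph0_iff.mp cardinalMk_algebraicClosure_rat_le_aleph0
  have hK : #(AlgebraicClosure ℚ) ≤ ℵ₀ := cardinalMk_algebraicClosure_rat_le_aleph0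
  haveI : LocallyOfFiniteType S₀.hom := locallyOfFiniteType_of_isQuasiProjectiveOver hS₀
  haveI : QuasiCompact S₀.hom := hS₀.isVarietyPair_ofScheme.quasiCompact
  haveI : CompactSpace S₀.left := QuasiCompact.compactSpace_of_compactSpace S₀.hom
  haveI : Countable S₀.left := countable_of_locallyOfFiniteType S₀.hom
  -- notation
  let S : SchemeOver ℂ := (baseChangeHom σ).obj S₀
  let f : (baseChangeHom σ).obj 𝒳₀ ⟶ S := (baseChangeHom σ).map f₀
  let prS : S.left ⟶ S₀.left := baseChangeHomFst σ S₀
  let L : Set (ComplexPoints S) :=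
    {t | complexBetti.map (fiberι f t) (2 * p) A ∈ algebraicClasses (fiberOver f t) p}
  -- the points of `S₀` under the locus
  let G : Set S₀.left := {x | ∃ w : ComplexPoints S, prS.base w.pt = x ∧ w ∈ L}
  -- ### key step: the locus is saturated along the closure of each of its points of `S₀`
  have key : ∀ x ∈ G, ∀ t : ComplexPoints S, prS.base t.pt ∈ closure ({x} : Set S₀.left) → t ∈ L := by
    rintro x ⟨w, hwx, hwL⟩ t htx
    -- the closed subscheme `Y = V(closure {x})` of `S₀`
    let Z : Closeds S₀.left := ⟨closure {x}, isClosed_closure⟩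
    let I : S₀.left.IdealSheafData := Scheme.IdealSheafData.vanishingIdeal Z
    let Y₀ : SchemeOver (AlgebraicClosure ℚ) := Over.mk (I.subschemeι ≫ S₀.hom)
    let ι₀ : Y₀ ⟶ S₀ := Over.homMk I.subschemeι rfl
    have hrange : Set.range ι₀.left.base = closure {x} := by
      change Set.range I.subschemeι.base = closure {x}
      rw [Scheme.IdealSheafData.range_subschemeι, Scheme.IdealSheafData.coe_support_vanishingIdeal]
      rfl
    haveI : IsClosedImmersion ι₀.left := inferInstanceAs (IsClosedImmersion I.subschemeι)
    haveI : LocallyOfFiniteType ι₀.left := inferInstance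
    haveI : LocallyOfFiniteType Y₀.hom := by rw [← Over.w ι₀]; infer_instance
    -- a point `y₀` of `Y₀` over `x`; it is a generic point, so `Y₀` is irreducible
    obtain ⟨y₀, hy₀⟩ : x ∈ Set.range ι₀.left.base := by
      rw [hrange]; exact subset_closure (Set.mem_singleton x)
    have hcl : closure ({y₀} : Set Y₀.left) = Set.univ := by
      rw [ι₀.left.isClosedEmbedding.isInducing.closure_eq_preimage_closure_image,
        Set.image_singleton, hy₀, ← hrange, Set.preimage_range]
    haveI : IrreducibleSpace Y₀.left :=
      (irreducibleSpace_def _).2 (IsGenericPoint.isIrreducible (S := Set.univ) hcl)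
    have hgen : genericPoint Y₀.left = y₀ := (genericPoint_spec Y₀.left).eq hcl
    -- pull the family back to `Y₀`
    obtain ⟨hf', hfib⟩ := familyPullback_baseChangeHom σ f₀ ι₀ hf p A
    -- lift `w` over the generic point of `Y₀`, and `t`
    have hη : ι₀.left.base (genericPoint Y₀.left) = prS.base w.pt := by rw [hgen, hy₀, hwx]
    obtain ⟨w', hw'η, hw'w⟩ := exists_map_eq_of_base_pt_eq (σ := σ) ι₀ hK hη
    obtain ⟨yt, hyt⟩ : prS.base t.pt ∈ Set.range ι₀.left.base := by rw [hrange]; exact htx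
    obtain ⟨t', -, ht't⟩ := exists_map_eq_of_base_pt_eq (σ := σ) ι₀ hK (y := yt) (t := t) hyt
    have hA' := (hfib w').mpr (by rw [hw'w]; exact hwL)
    have ht' := mem_algebraicClasses_of_base_pt_eq_genericPoint (AlgebraicClosure ℚ) σ
      (familyPullback.snd f₀ ι₀) hf' p _ w' hw'η hA' t'
    have ht := (hfib t').mp ht'
    rw [ht't] at ht
    exact ht
  -- ### the countably many closed strata
  let 𝒲 : Set (Set S₀.left) := insert ∅ ((fun x => closure ({x} : Set S₀.left)) '' G)
  have h𝒲c : 𝒲.Countable := ((Set.to_countable G).image _).insert _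
  have h𝒲ne : 𝒲.Nonempty := ⟨∅, Set.mem_insert _ _⟩
  obtain ⟨W, hW⟩ := h𝒲c.exists_eq_range h𝒲ne
  have hWmem : ∀ j, W j ∈ 𝒲 := fun j => hW ▸ Set.mem_range_self j
  refine ⟨W, fun j => ?_, ?_⟩
  · rcases Set.mem_insert_iff.1 (hWmem j) with h | ⟨x, -, h⟩
    · rw [h]; exact isClosed_empty
    · rw [← h]; exact isClosed_closure
  · ext t
    simp only [Set.mem_iUnion, Set.mem_setOf_eq]
    constructor
    · intro ht
      have hxG : prS.base t.pt ∈ G := ⟨t, rfl, ht⟩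
      have hmem : closure ({prS.base t.pt} : Set S₀.left) ∈ 𝒲 :=
        Set.mem_insert_of_mem _ ⟨_, hxG, rfl⟩
      rw [hW] at hmem
      obtain ⟨j, hj⟩ := hmem
      exact ⟨j, by rw [hj]; exact subset_closure (Set.mem_singleton _)⟩
    · rintro ⟨j, hj⟩
      rcases Set.mem_insert_iff.1 (hWmem j) with h | ⟨x, hxG, h⟩
      · rw [h] at hj; exact absurd hj (Set.notMem_empty _)
      · rw [← h] at hj
        exact key x hxG t hj

end Part4

end Literature.AlgebraicGeometry.HodgeTheory.AlgebraicityLocusPropagation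

end
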